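import Literature.Barriers.CriticalPhenomena.WeaklySAWPerturbativeXi
import Literature.Barriers.CriticalPhenomena.WeaklySAWPerturbativeBetaA1
import Literature.Barriers.CriticalPhenomena.WeaklySAWCouplingFlowCutoff
import HarnessLib

/-!
# BBS 2015, §6.1: Assumption (A2) HOLDS for the weakly self-avoiding walk in `d = 4` —
# [BBS-rg-pt] Proposition 4.2.2 for the explicit `φ̄`: `θ_j, η_j, ξ_j, π_j = O(χ_j)`

End point of the `(A2)` line (`WeaklySAWPerturbativeCoefficients/EtaTheta/Pi/Xi.lean`: the
coefficients of `φ̄` on the explicit decomposition and their bounds `|·| ≤ K_L(1+L^{2j}m²/(8+m²))^{-p}`)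
together with the `(A1)` line (`WeaklySAWPerturbativeBetaA1.lean`: `HypA1` for the explicit `β`,
`j_Ω = j_m + O(1)`). Bauerschmidt–Brydges–Slade, CMP 337 (2015) [BBS2015], §6.1:

"**Assumption (A2).** The other parameters of `φ̄`: Each of `θ_j`, `η_j`, `ξ_j`, and `π_j` is bounded
in absolute value by `O(χ_j)`, with a constant that is independent of both `j` and `j_Ω`. The above
Assumption (A1) is the same as [BBS-rg-flow, Assumption (A1)], and the above Assumption (A2) is a
specialised form of [BBS-rg-flow, Assumption (A2)] (where in the notation of [BBS-rg-flow],
`ζ_j = 0`, `υ_j^{gg} = ξ_j`, `υ_j^{gz} = π_j`, `υ_j^{gμ} = L²γβ_j`, and `υ_j^{zz} = υ_j^{zμ} = 0`)", and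
"In [BBS-rg-pt], it is verified that … [these] assumptions are satisfied" — [BBS-rg-pt] =
R. Bauerschmidt, D. C. Brydges, G. Slade, J. Stat. Phys. **159** (2015), arXiv:1403.7252,
Proposition 4.2.2 ("the map `φ̄` satisfies [BBS-rg-flow, Assumptions (A1–A2)]"), proved in §6.3 from
Lemma 6.1.2 and "(mOmega) `Ω^{-(j-j_m)₊} = O(Ω^{-(j-j_Ω)₊})`".

## What this file proves (everything; no definition, no named fact), `L ≥ 2`, `Ω > 1`

* `decayFactor_le_cutoff` — "`(1+m²L^{2j})^{-k} ≤ L^{-2k(j-j_m)₊} ≤ Ω^{-(j-j_m)₊}`" quantitatively: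
  `ϑ_j ≤ 9^kΩ·Ω^{-(j-j_m)₊}` for `k` with `L^{2k} ≥ Ω`;
* `chi_betaPT_ge` — (mOmega): `χ_j ≥ Ω^{-M}Ω^{-(j-j_m)₊}` for `m² ∈ (0,δ]` (from `j_m ≤ j_Ω + M`);
  `decayFactor_le_chi` — hence `ϑ_j ≤ Dχ_j`; `chi_betaPT_zero` — `χ_j = 1` at `m² = 0`;
* **`hypA2_wsawQuadFlow`** — Assumption (A2) of [BBS-rg-flow] for `φ̄` of the weakly self-avoiding
  walk (`wsawQuadFlow L m²`, `λ_j = L²`, no exceptional `ζ`-scales so any `c > 0`): there are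
  `δ ∈ (0,1]` and `C` with `HypA2 (wsawQuadFlow L m²) Ω (L²) c C` for every `m² ∈ [0,δ]`, `c > 0`;
* **`hypA1_and_hypA2_wsawQuadFlow`** — (A1) and (A2) together, with the same `c`, uniformly in
  `m² ∈ [0,δ]` (Proposition 4.2.2 of [BBS-rg-pt], the `φ̄`-part, for the explicit decomposition).
-/

noncomputable section

open Set Filter Topology
open Literature.Probability.LatticeModels
open scoped BigOperators

namespace Literature.Barriers.CriticalPhenomena

namespace CTWSAW

open LongRangePhi4 LongRangePhi4.FRD PT

/-! ### The decay factor against `Ω^{-(j-j_m)₊}` and against `χ_j` -/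

/-- **`ϑ_j = (1+L^{2j}s/(8+s))^{-k} ≤ 9^kΩ·Ω^{-(j-j_m)₊}`** for `s ∈ (0,1]`, `j_m` with `sL^{2(j_m+1)} > 1`,
and `k` with `L^{2k} ≥ Ω` ("let `k` be such that `L^{2k} ≥ Ω`; then `(1+m²L^{2j})^{-k} ≤ L^{-2k(j-j_m)₊} ≤
Ω^{-(j-j_m)₊}`"). [cite: BauerschmidtBrydgesSlade2015LogCorr, §6.1 ([BBS-rg-pt] proof of Proposition 4.2.2, first display)] -/
theorem decayFactor_le_cutoff {Ω : ℝ} (hΩ : 1 < Ω) {L : ℝ} (hL : 2 ≤ L) {k : ℕ} (hk : Ω ≤ (L ^ 2) ^ k)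
    {s : ℝ} (hs : 0 < s) (hs1 : s ≤ 1) {jm : ℕ} (hjm : 1 < s * L ^ (2 * (jm + 1))) (j : ℕ) :
    ((1 + L ^ (2 * j) * s / (8 + s)) ^ k)⁻¹ ≤ 9 ^ k * Ω * (Ω ^ (j - jm))⁻¹ := by
  have hL0 : (0 : ℝ) < L := by linarith
  have hΩ0 : 0 < Ω := by linarith
  set ϑ : ℝ := ((1 + L ^ (2 * j) * s / (8 + s)) ^ k)⁻¹ with hϑdef
  have hϑ1 : ϑ ≤ 1 := by
    rw [hϑdef]
    refine inv_le_one_of_one_le₀ (one_le_pow₀ ?_)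
    have : 0 ≤ L ^ (2 * j) * s / (8 + s) := by positivity
    linarith
  have h9 : (1 : ℝ) ≤ 9 ^ k * Ω := by
    have : (1 : ℝ) ≤ 9 ^ k := one_le_pow₀ (by norm_num)
    nlinarith
  rcases le_or_gt j jm with hj | hj
  · rw [Nat.sub_eq_zero_of_le hj, pow_zero, inv_one, mul_one]
    exact hϑ1.trans h9
  · obtain ⟨r, hr⟩ := Nat.exists_eq_add_of_lt hj
    have hjr : j - jm = r + 1 := by omega
    rw [hjr]
    have hX : L ^ (2 * r) ≤ L ^ (2 * j) * s := by
      have e : L ^ (2 * j) * s = L ^ (2 * r) * (s * L ^ (2 * (jm + 1))) := by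
        rw [hr, show 2 * (jm + r + 1) = 2 * r + 2 * (jm + 1) by ring, pow_add]; ring
      rw [e]
      have : 0 ≤ L ^ (2 * r) := by positivity
      nlinarith
    have hbase : L ^ (2 * r) / 9 ≤ 1 + L ^ (2 * j) * s / (8 + s) := by
      have h8 : L ^ (2 * j) * s / 9 ≤ L ^ (2 * j) * s / (8 + s) :=
        div_le_div_of_nonneg_left (by positivity) (by positivity) (by linarith)
      have : L ^ (2 * r) / 9 ≤ L ^ (2 * j) * s / 9 := div_le_div_of_nonneg_right hX (by norm_num)
      linarith
    have hb9 : 0 < L ^ (2 * r) / 9 := by positivity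
    have h1 : ϑ ≤ ((L ^ (2 * r) / 9) ^ k)⁻¹ := by
      rw [hϑdef]; exact inv_anti₀ (pow_pos hb9 k) (pow_le_pow_left₀ hb9.le hbase k)
    have h2 : ((L ^ (2 * r) / 9) ^ k)⁻¹ = 9 ^ k * (((L ^ 2) ^ k) ^ r)⁻¹ := by
      rw [div_pow, inv_div, ← pow_mul, ← pow_mul, ← pow_mul, show 2 * r * k = 2 * (k * r) by ring,
        div_eq_mul_inv]
    have h3 : (((L ^ 2) ^ k) ^ r)⁻¹ ≤ (Ω ^ r)⁻¹ := inv_anti₀ (pow_pos hΩ0 r) (pow_le_pow_left₀ hΩ0.le hk r)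
    calc ϑ ≤ 9 ^ k * (((L ^ 2) ^ k) ^ r)⁻¹ := h1.trans (le_of_eq h2)
      _ ≤ 9 ^ k * (Ω ^ r)⁻¹ := mul_le_mul_of_nonneg_left h3 (by positivity)
      _ = 9 ^ k * Ω * (Ω ^ (r + 1))⁻¹ := by rw [pow_succ, mul_inv]; field_simp

/-- **(mOmega): `χ_j ≥ Ω^{-M}Ω^{-(j-j_m)₊}`** for the explicit `β` at `m² ∈ (0,δ]` — from `j_m ≤ j_Ω + M`
(`jOmega_betaPT_massScale`). [cite: BauerschmidtBrydgesSlade2015LogCorr, §6.1 ([BBS-rg-pt] proof of Proposition 4.2.2, display (mOmega): Ω^{-(j-j_m)₊} = O(Ω^{-(j-j_Ω)₊}))] -/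
theorem chi_betaPT_ge {L : ℝ} (hL : 2 ≤ L) {Ω : ℝ} (hΩ : 1 < Ω) :
    ∃ δ : ℝ, 0 < δ ∧ δ ≤ 1 ∧ ∃ M : ℕ, ∀ s : ℝ, 0 < s → s ≤ δ → ∀ jm : ℕ,
      s * L ^ (2 * jm) ≤ 1 → 1 < s * L ^ (2 * (jm + 1)) → ∀ j : ℕ,
        (Ω ^ M)⁻¹ * (Ω ^ (j - jm))⁻¹ ≤ chi (betaPT 4 L s) Ω j := by
  have hΩ0 : 0 < Ω := by linarith
  obtain ⟨δ, hδ, hδ1, M, hM⟩ := jOmega_betaPT_massScale hL hΩ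
  refine ⟨δ, hδ, hδ1, M, fun s hs hsδ jm hjm1 hjm2 j => ?_⟩
  obtain ⟨hup, hlow⟩ := hM s hs hsδ jm hjm1 hjm2
  -- `j_Ω` is finite
  have hfin : jOmega (betaPT 4 L s) Ω ≠ ⊤ := by
    intro htop; rw [htop] at hup; exact absurd hup (by simp)
  obtain ⟨k, hk⟩ := ENat.ne_top_iff_exists.1 hfin
  have hk' : jOmega (betaPT 4 L s) Ω = k := hk.symm
  unfold chi
  rw [hk', cutoffWeight_coe]
  have hkM : jm ≤ k + M := by
    rw [hk'] at hlow; exact_mod_cast hlow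
  have hexp : j - k ≤ (j - jm) + M := by omega
  rw [← mul_inv, ← pow_add]
  refine inv_anti₀ (pow_pos hΩ0 _) ?_
  rw [add_comm]
  exact pow_le_pow_right₀ hΩ.le hexp

/-- **`ϑ_j ≤ Dχ_j`** for `m² ∈ (0,δ]`: the decay factor of the coefficient bounds is `O(χ_j)`, for a
`k = k(L,Ω)` and uniform `D`, `δ`. [cite: BauerschmidtBrydgesSlade2015LogCorr, §6.1 ([BBS-rg-pt] proof of Proposition 4.2.2, (mOmega) and the first display)] -/
theorem decayFactor_le_chi {L : ℝ} (hL : 2 ≤ L) {Ω : ℝ} (hΩ : 1 < Ω) :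
    ∃ δ D : ℝ, 0 < δ ∧ δ ≤ 1 ∧ 0 < D ∧ ∃ k : ℕ, ∀ s : ℝ, 0 < s → s ≤ δ → ∀ j : ℕ,
      ((1 + L ^ (2 * j) * s / (8 + s)) ^ k)⁻¹ ≤ D * chi (betaPT 4 L s) Ω j := by
  have hL1 : (1 : ℝ) < L := by linarith
  have hΩ0 : 0 < Ω := by linarith
  obtain ⟨k, hk⟩ := exists_pow_sq_ge hL1 Ω
  obtain ⟨δ, hδ, hδ1, M, hM⟩ := chi_betaPT_ge hL hΩ
  refine ⟨δ, 9 ^ k * Ω * Ω ^ M, hδ, hδ1, by positivity, k, fun s hs hsδ j => ?_⟩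
  have hs1 : s ≤ 1 := hsδ.trans hδ1
  obtain ⟨jm, hjm1, hjm2⟩ := exists_massScale hL1 hs hs1
  have h1 := decayFactor_le_cutoff hΩ hL hk hs hs1 hjm2 j
  have h2 := hM s hs hsδ jm hjm1 hjm2 j
  have h3 : (Ω ^ (j - jm))⁻¹ ≤ Ω ^ M * chi (betaPT 4 L s) Ω j := by
    have := mul_le_mul_of_nonneg_left h2 (pow_pos hΩ0 M).le
    rwa [← mul_assoc, mul_inv_cancel₀ (pow_pos hΩ0 M).ne', one_mul] at this
  calc ((1 + L ^ (2 * j) * s / (8 + s)) ^ k)⁻¹ ≤ 9 ^ k * Ω * (Ω ^ (j - jm))⁻¹ := h1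
    _ ≤ 9 ^ k * Ω * (Ω ^ M * chi (betaPT 4 L s) Ω j) := mul_le_mul_of_nonneg_left h3 (by positivity)
    _ = 9 ^ k * Ω * Ω ^ M * chi (betaPT 4 L s) Ω j := by ring

/-- At `m² = 0`, `χ_j = 1` for all `j` (`j_Ω = ∞`). [cite: BauerschmidtBrydgesSlade2015LogCorr, §6.1 (χ_j = Ω^{-(j-j_Ω)₊}; j_Ω = ∞ at m² = 0)] -/
theorem chi_betaPT_zero {L : ℝ} (hL : 2 ≤ L) {Ω : ℝ} (hΩ : 1 < Ω) (j : ℕ) : chi (betaPT 4 L 0) Ω j = 1 :=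
  chi_eq_one_of_le (by rw [jOmega_betaPT_zero hL hΩ]; exact le_top)

/-! ### Assumption (A2) -/

/-- **BBS 2015, Assumption (A2) HOLDS for the weakly self-avoiding walk in `d = 4`**: for `L ≥ 2`,
`Ω > 1` there are `δ ∈ (0,1]` and `C` such that `φ̄(m²) = wsawQuadFlow L m²` satisfies
`HypA2 (φ̄(m²)) Ω L² c C` for every `m² ∈ [0,δ]` and every `c > 0` (the constant `c` of (A2) only
enters through the exceptional set of `ζ`, empty here): `λ_j = L² > 1`; no `ζ` (`ζ_j = 0`); `|η_j|, |θ_j|, |ξ_j| (= υ^{gg}), |π_j| (= υ^{gz})| ≤ Cχ_j` by Lemma 6.1.2 (`≤ K_Lϑ_j`) and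
`ϑ_j ≤ Dχ_j` for `m² > 0`, `χ_j = 1` for `m² = 0`; `|υ^{gμ}_j| = L²¼|β_j| ≤ ¼L²Bχ_j` by (A1);
`γ_j = ζ_j = υ^{zz}_j = υ^{zμ}_j = 0`.
[cite: BauerschmidtBrydgesSlade2015LogCorr, §6.1, Assumption (A2) ("In [BBS-rg-pt], it is verified that … [it is] satisfied"; [BBS-rg-pt] = arXiv:1403.7252, Proposition 4.2.2 and its proof in §6.3)] -/
theorem hypA2_wsawQuadFlow {L : ℝ} (hL : 2 ≤ L) {Ω : ℝ} (hΩ : 1 < Ω) :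
    ∃ δ C : ℝ, 0 < δ ∧ δ ≤ 1 ∧ 0 < C ∧ ∀ c : ℝ, 0 < c → ∀ s : ℝ, 0 ≤ s → s ≤ δ →
      HypA2 (wsawQuadFlow L s) Ω (L ^ 2) c C := by
  have hL0 : (0 : ℝ) < L := by linarith
  have hL1 : (1 : ℝ) < L := by linarith
  -- (A1) data for `υ^{gμ} = L²¼β`
  obtain ⟨δ₁, B, c₁, hδ₁, hδ₁1, hA1⟩ := hypA1_betaPT hL hΩ
  have hBnn : 0 ≤ B := (hA1 0 le_rfl hδ₁.le).B_nonneg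
  -- the decay factor is `O(χ_j)`
  obtain ⟨δ₂, D, hδ₂, hδ₂1, hD, k, hDχ⟩ := decayFactor_le_chi hL hΩ
  -- coefficient bounds, massive (with decay) and massless
  obtain ⟨Kη, hKη, hη⟩ := abs_etaPT_le_decay k
  obtain ⟨Kθ, hKθ, hθ⟩ := abs_thetaPT_le_decay k
  obtain ⟨Kπ, hKπ, hπ⟩ := abs_piPT_le_decay k
  obtain ⟨Kξ, hKξ, hξ⟩ := abs_xiPT_le_decay k
  obtain ⟨Kη0, hKη0, hη0⟩ := abs_etaPT_le
  obtain ⟨Kθ0, hKθ0, hθ0⟩ := abs_thetaPT_le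
  obtain ⟨Kπ0, hKπ0, hπ0⟩ := abs_piPT_le
  obtain ⟨Kξ0, hKξ0, hξ0⟩ := abs_xiPT_le
  set δ : ℝ := min δ₁ δ₂ with hδdef
  set C : ℝ := (Kη0 * L ^ 2 + Kθ0 * L ^ 6 + Kπ0 * L ^ 6 + Kξ0 * L ^ 10) +
    (Kη * L ^ 2 + Kθ * L ^ 6 + Kπ * L ^ 6 + Kξ * L ^ 10) * D + L ^ 2 * (1 / 4) * B with hCdef
  have hC0 : 0 < C := by positivity
  refine ⟨δ, C, lt_min hδ₁ hδ₂, (min_le_left _ _).trans hδ₁1, hC0, fun c hc s hs hsδ => ?_⟩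
  have hs₁ : s ≤ δ₁ := hsδ.trans (min_le_left _ _)
  have hs₂ : s ≤ δ₂ := hsδ.trans (min_le_right _ _)
  have hA1s : HypA1 (betaPT 4 L s) Ω B c₁ := hA1 s hs hs₁
  have hchi : ∀ j, 0 < chi (betaPT 4 L s) Ω j ∧ chi (betaPT 4 L s) Ω j ≤ 1 := fun j =>
    chi_pos_and_le_one _ hΩ.le j
  -- the generic step: a bound `K₀Lⁿ` (all `s`) and `KLⁿϑ` (`s > 0`) give `≤ Cχ_j` once `K₀Lⁿ + KLⁿD ≤ C`
  have key : ∀ (v : ℝ) (K0 K : ℝ) (n : ℕ) (j : ℕ), 0 ≤ K0 → 0 ≤ K →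
      K0 * L ^ n + K * L ^ n * D ≤ C →
      |v| ≤ K0 * L ^ n → (0 < s → |v| ≤ K * L ^ n * ((1 + L ^ (2 * j) * s / (8 + s)) ^ k)⁻¹) →
      |v| ≤ C * chi (betaPT 4 L s) Ω j := by
    intro v K0 K n j hK0 hK hKC h0 hpos
    obtain ⟨hχ0, hχ1⟩ := hchi j
    rcases hs.lt_or_eq with hs' | hs'
    · have h1 := hpos hs'
      have h2 := hDχ s hs' hs₂ j
      calc |v| ≤ K * L ^ n * ((1 + L ^ (2 * j) * s / (8 + s)) ^ k)⁻¹ := h1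
        _ ≤ K * L ^ n * (D * chi (betaPT 4 L s) Ω j) := mul_le_mul_of_nonneg_left h2 (by positivity)
        _ = (K * L ^ n * D) * chi (betaPT 4 L s) Ω j := by ring
        _ ≤ C * chi (betaPT 4 L s) Ω j := by
            refine mul_le_mul_of_nonneg_right ?_ hχ0.le
            have : 0 ≤ K0 * L ^ n := by positivity
            linarith
    · subst hs'
      rw [chi_betaPT_zero hL hΩ j, mul_one]
      refine h0.trans ?_
      have : 0 ≤ K * L ^ n * D := by positivity
      linarith
  have hCη : Kη0 * L ^ 2 + Kη * L ^ 2 * D ≤ C := by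
    rw [hCdef]
    have : 0 ≤ Kθ0 * L ^ 6 + Kπ0 * L ^ 6 + Kξ0 * L ^ 10 + (Kθ * L ^ 6 + Kπ * L ^ 6 + Kξ * L ^ 10) * D +
      L ^ 2 * (1 / 4) * B := by positivity
    nlinarith
  have hCθ : Kθ0 * L ^ 6 + Kθ * L ^ 6 * D ≤ C := by
    rw [hCdef]
    have : 0 ≤ Kη0 * L ^ 2 + Kπ0 * L ^ 6 + Kξ0 * L ^ 10 + (Kη * L ^ 2 + Kπ * L ^ 6 + Kξ * L ^ 10) * D +
      L ^ 2 * (1 / 4) * B := by positivity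
    nlinarith
  have hCπ : Kπ0 * L ^ 6 + Kπ * L ^ 6 * D ≤ C := by
    rw [hCdef]
    have : 0 ≤ Kη0 * L ^ 2 + Kθ0 * L ^ 6 + Kξ0 * L ^ 10 + (Kη * L ^ 2 + Kθ * L ^ 6 + Kξ * L ^ 10) * D +
      L ^ 2 * (1 / 4) * B := by positivity
    nlinarith
  have hCξ : Kξ0 * L ^ 10 + Kξ * L ^ 10 * D ≤ C := by
    rw [hCdef]
    have : 0 ≤ Kη0 * L ^ 2 + Kθ0 * L ^ 6 + Kπ0 * L ^ 6 + (Kη * L ^ 2 + Kθ * L ^ 6 + Kπ * L ^ 6) * D +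
      L ^ 2 * (1 / 4) * B := by positivity
    nlinarith
  have hzero : ∀ j, |(0 : ℝ)| ≤ C * chi (betaPT 4 L s) Ω j := fun j => by
    rw [abs_zero]; exact mul_nonneg hC0.le (hchi j).1.le
  refine
    { one_lt_lam := by nlinarith
      lam_le := fun j => le_rfl
      c_pos := hc
      zeta_exc := ⟨∅, by rw [Finset.card_empty, Nat.cast_zero]; exact inv_nonneg.2 hc.le,
        fun j _ _ => le_rfl⟩
      eta_le := fun j => key _ Kη0 Kη 2 j hKη0.le hKη.le hCη (hη0 L hL s hs j) (fun hs' => hη L hL s hs' j)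
      gamma_le := fun j => hzero j
      theta_le := fun j => key _ Kθ0 Kθ 6 j hKθ0.le hKθ.le hCθ (hθ0 L hL s hs j) (fun hs' => hθ L hL s hs' j)
      zeta_le := fun j => hzero j
      υgg_le := fun j => key _ Kξ0 Kξ 10 j hKξ0.le hKξ.le hCξ (hξ0 L hL s hs j) (fun hs' => hξ L hL s hs' j)
      υgz_le := fun j => key _ Kπ0 Kπ 6 j hKπ0.le hKπ.le hCπ (hπ0 L hL s hs j) (fun hs' => hπ L hL s hs' j)
      υgμ_le := fun j => ?_
      υzz_le := fun j => hzero j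
      υzμ_le := fun j => hzero j }
  -- `υ^{gμ}_j = L²¼β_j`
  show |omegaPT 4 L s j| ≤ C * chi (betaPT 4 L s) Ω j
  unfold omegaPT
  rw [abs_mul, abs_of_pos (by positivity : (0 : ℝ) < L ^ 2 * (1 / 4))]
  have hβ := hA1s.abs_le_mul_chi hΩ.le j
  obtain ⟨hχ0, -⟩ := hchi j
  calc L ^ 2 * (1 / 4) * |betaPT 4 L s j| ≤ L ^ 2 * (1 / 4) * (B * chi (betaPT 4 L s) Ω j) :=
        mul_le_mul_of_nonneg_left hβ (by positivity)
    _ = (L ^ 2 * (1 / 4) * B) * chi (betaPT 4 L s) Ω j := by ring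
    _ ≤ C * chi (betaPT 4 L s) Ω j := by
        refine mul_le_mul_of_nonneg_right ?_ hχ0.le
        rw [hCdef]
        have : 0 ≤ (Kη0 * L ^ 2 + Kθ0 * L ^ 6 + Kπ0 * L ^ 6 + Kξ0 * L ^ 10) +
          (Kη * L ^ 2 + Kθ * L ^ 6 + Kπ * L ^ 6 + Kξ * L ^ 10) * D := by positivity
        linarith

/-- **[BBS-rg-pt] Proposition 4.2.2 (the `φ̄`-part) for the weakly self-avoiding walk, PROVED:
Assumptions (A1) and (A2) of [BBS-rg-flow] hold for `φ̄(m²)`, uniformly in `m² ∈ [0,δ]`** (`L ≥ 2`,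
`Ω > 1`): there are `δ ∈ (0,1]`, `B, c, C` with `HypA1 (β(m²)) Ω B c` and
`HypA2 (φ̄(m²)) Ω L² c C` (same `c`) for every `m² ∈ [0,δ]` — the hypotheses on `φ̄` under which
[BBS-rg-flow, Proposition 1.2] (the tree's `quadFlow_exists_unique`) gives BBS 2015, Proposition 6.1.1,
and BBS 2015, Theorem 7.2.1 / the tree's `BBS_thm14_exists_flow` produce the flow of Proposition 7.1.
[cite: BauerschmidtBrydgesSlade2015LogCorr, §6.1, Assumptions (A1)–(A2) ("In [BBS-rg-pt], it is verified that … the following two assumptions are satisfied")] -/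
theorem hypA1_and_hypA2_wsawQuadFlow {L : ℝ} (hL : 2 ≤ L) {Ω : ℝ} (hΩ : 1 < Ω) :
    ∃ δ B c C : ℝ, 0 < δ ∧ δ ≤ 1 ∧ ∀ s : ℝ, 0 ≤ s → s ≤ δ →
      HypA1 (wsawQuadFlow L s).β Ω B c ∧ HypA2 (wsawQuadFlow L s) Ω (L ^ 2) c C := by
  obtain ⟨δ₁, B, c, hδ₁, hδ₁1, hA1⟩ := hypA1_betaPT hL hΩ
  obtain ⟨δ₂, C, hδ₂, hδ₂1, -, hA2⟩ := hypA2_wsawQuadFlow hL hΩ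
  have hc : 0 < c := (hA1 0 le_rfl hδ₁.le).c_pos
  refine ⟨min δ₁ δ₂, B, c, C, lt_min hδ₁ hδ₂, (min_le_left _ _).trans hδ₁1, fun s hs hsδ => ⟨?_, ?_⟩⟩
  · exact hA1 s hs (hsδ.trans (min_le_left _ _))
  · exact hA2 c hc s hs (hsδ.trans (min_le_right _ _))

end CTWSAW

end Literature.Barriers.CriticalPhenomena
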